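import Summits.Parity.GeneralizedHardyLittlewood.Theorems.PrimeLevelFamEdgeMomentsBeyondDiagonalLayersRegroup
import Summits.Parity.GeneralizedHardyLittlewood.Theorems.PrimeLevelFamEdgeMomentsBeyondDiagonalLayersPascadiBridge
import HarnessLib

/-!
# Route `PrimeLevelFamEdge`, crux K_A `MomentsBeyondDiagonal` (stmt-Parity-20007), line «petersson_layers» v4:
# the PRINT-BAND SAVING for a regrouped four-variable layer form (CONDITIONAL on Pascadi's Theorem 7.1)

Twin of `…LayersBlockFourierBound` with the completion bound replaced by the Pascadi bridge
(`…LayersPascadiBridge.norm_bilinear_dilated_le_of_pascadi`, named fact `pascadi2025_theorem71` as a HYPOTHESIS): for a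
separated form `Σ_{m₁,n₁,m₂,n₂} A(m₁,m₂)B(n₁,n₂)κ` of a Petersson layer block at modulus `qr` (`q` prime, `q ∤ r`) whose kernel
is, on the support, the dilated Kloosterman sum `S(σ₁·m₁m₂, σ₂·n₁n₂; qr)` (`σ₁ = σ₂ = 1`: the good terms; general `σ`: a sharp-data
group after the gcd extraction, `…LayersKloostermanScale` / `…LayersCoprimality`) with Pascadi's coprimality on the support,

  `‖Σ A·B·κ‖ ≤ C_ε √D₁ √D₂ ‖A‖₂ ‖B‖₂ (qr)^{1+ε} (r(σ₁U)³(σ₂V)/(qr)³ + r(σ₁U)²/(qr)² + 1/r)^{1/6}`,  `U = X₁X₂`, `V = Y₁Y₂`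

(`norm_sum_four_le_of_pascadi`; `1 ≤ σ₂V ≤ σ₁U ≤ qr`, divisor bounds `τ ≤ Dᵢ`).  This is the per-form inequality from which
the print band `SubBand rhoP rhoWeil` of `stub_farP` is summed (census CENSUS-leafhand2-g0 on the crux item, remaining steps L2–L7).
Proof only (def-free, CONDITIONAL helper); K_A NOT proved; nothing of Pascadi's proof is formalised; nothing about Landau–Siegel zeros.
-/

noncomputable section

open Finset
open Literature.NumberTheory.LFunctions

namespace Summit.Parity.GeneralizedHardyLittlewood.Theorems.MomentsBeyondDiagonal.Layers

/-- A non-vanishing convolution coefficient has a non-vanishing summand. [folklore] -/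
theorem exists_ne_zero_of_fiber_sum_ne_zero {X₁ X₂ : ℕ} {A : ℕ → ℕ → ℂ} {u : ℕ}
    (h : ∑ p ∈ (Icc 1 X₁ ×ˢ Icc 1 X₂).filter (fun p : ℕ × ℕ ↦ p.1 * p.2 = u), A p.1 p.2 ≠ 0) :
    ∃ m₁ ∈ Icc 1 X₁, ∃ m₂ ∈ Icc 1 X₂, m₁ * m₂ = u ∧ A m₁ m₂ ≠ 0 := by
  obtain ⟨p, hp, hA⟩ := Finset.exists_ne_zero_of_sum_ne_zero h
  simp only [mem_filter, mem_product] at hp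
  exact ⟨p.1, hp.1.1, p.2, hp.1.2, hp.2, hA⟩

/-- **The print-band saving for a regrouped separated form (CONDITIONAL on `pascadi2025_theorem71`).**
[cite: Pascadi2025, Thm. 7.1 (case c = qr, a = 1)] -/
theorem norm_sum_four_le_of_pascadi (h : pascadi2025_theorem71) {ε : ℝ} (hε : 0 < ε) :
    ∃ C : ℝ, ∀ (q r : ℕ) [NeZero (q * r)], q.Prime → ¬ q ∣ r →
      ∀ (σ₁ σ₂ X₁ X₂ Y₁ Y₂ : ℕ), 0 < σ₁ → 0 < σ₂ →
        1 ≤ σ₂ * (Y₁ * Y₂) → σ₂ * (Y₁ * Y₂) ≤ σ₁ * (X₁ * X₂) → σ₁ * (X₁ * X₂) ≤ q * r →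
      ∀ (A B : ℕ → ℕ → ℂ) (κ : ℕ → ℕ → ℕ → ℕ → ℂ),
        (∀ m₁ ∈ Icc 1 X₁, ∀ m₂ ∈ Icc 1 X₂, ∀ n₁ ∈ Icc 1 Y₁, ∀ n₂ ∈ Icc 1 Y₂, A m₁ m₂ * B n₁ n₂ ≠ 0 →
          κ m₁ n₁ m₂ n₂ = kloostermanSum (q * r) ((σ₁ * (m₁ * m₂) : ℕ) : ZMod (q * r)) ((σ₂ * (n₁ * n₂) : ℕ) : ZMod (q * r)) ∧
          Nat.Coprime (Nat.gcd (σ₁ * (m₁ * m₂)) (σ₂ * (n₁ * n₂))) (q * r)) →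
      ∀ (D₁ D₂ : ℝ), 0 ≤ D₁ → 0 ≤ D₂ →
        (∀ u ∈ Icc 1 (X₁ * X₂), (#u.divisors : ℝ) ≤ D₁) → (∀ v ∈ Icc 1 (Y₁ * Y₂), (#v.divisors : ℝ) ≤ D₂) →
        ‖∑ m₁ ∈ Icc 1 X₁, ∑ n₁ ∈ Icc 1 Y₁, ∑ m₂ ∈ Icc 1 X₂, ∑ n₂ ∈ Icc 1 Y₂, A m₁ m₂ * B n₁ n₂ * κ m₁ n₁ m₂ n₂‖ ≤
          C * Real.sqrt D₁ * Real.sqrt D₂ *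
            Real.sqrt (∑ p ∈ Icc 1 X₁ ×ˢ Icc 1 X₂, ‖A p.1 p.2‖ ^ 2) *
            Real.sqrt (∑ p ∈ Icc 1 Y₁ ×ˢ Icc 1 Y₂, ‖B p.1 p.2‖ ^ 2) *
            ((q * r : ℕ) : ℝ) ^ (1 + ε) *
            (Pascadi2025.bracket71 (σ₁ * (X₁ * X₂) : ℕ) (σ₂ * (Y₁ * Y₂) : ℕ) ((q * r : ℕ) : ℝ) r r) ^ (1 / 6 : ℝ) := by
  obtain ⟨C, hC⟩ := norm_bilinear_dilated_le_of_pascadi h hε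
  refine ⟨max C 0, ?_⟩
  intro q r _ hq hqr σ₁ σ₂ X₁ X₂ Y₁ Y₂ hσ₁ hσ₂ hN hNM hMc A B κ hsupp D₁ D₂ hD₁0 hD₂0 hD₁ hD₂
  -- regroup in `(u, v)` with the dilated kernel
  rw [sum_four_eq_bilinear_fiber_of_support X₁ X₂ Y₁ Y₂ A B κ
    (fun u v ↦ kloostermanSum (q * r) ((σ₁ * u : ℕ) : ZMod (q * r)) ((σ₂ * v : ℕ) : ZMod (q * r)))
    (fun m₁ hm₁ m₂ hm₂ n₁ hn₁ n₂ hn₂ hne ↦ (hsupp m₁ hm₁ m₂ hm₂ n₁ hn₁ n₂ hn₂ hne).1)]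
  set α : ℕ → ℂ := fun u ↦ ∑ p ∈ (Icc 1 X₁ ×ˢ Icc 1 X₂).filter (fun p : ℕ × ℕ ↦ p.1 * p.2 = u), A p.1 p.2 with hα
  set β : ℕ → ℂ := fun v ↦ ∑ p ∈ (Icc 1 Y₁ ×ˢ Icc 1 Y₂).filter (fun p : ℕ × ℕ ↦ p.1 * p.2 = v), B p.1 p.2 with hβ
  -- Pascadi's coprimality on the support of `α · β`
  have hcop : ∀ u ∈ Icc 1 (X₁ * X₂), ∀ v ∈ Icc 1 (Y₁ * Y₂), α u * β v ≠ 0 →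
      Nat.Coprime (Nat.gcd (σ₁ * u) (σ₂ * v)) (q * r) := by
    intro u _ v _ hne
    have hαu : α u ≠ 0 := left_ne_zero_of_mul hne
    have hβv : β v ≠ 0 := right_ne_zero_of_mul hne
    obtain ⟨m₁, hm₁, m₂, hm₂, hu, hA⟩ := exists_ne_zero_of_fiber_sum_ne_zero hαu
    obtain ⟨n₁, hn₁, n₂, hn₂, hv, hB⟩ := exists_ne_zero_of_fiber_sum_ne_zero hβv
    rw [← hu, ← hv]
    exact (hsupp m₁ hm₁ m₂ hm₂ n₁ hn₁ n₂ hn₂ (mul_ne_zero hA hB)).2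
  have key := hC q r hq hqr σ₁ σ₂ (X₁ * X₂) (Y₁ * Y₂) hσ₁ hσ₂ hN hNM hMc α β hcop
  -- the convolution ℓ² bounds
  have hAl := norm_sq_fiber_sum_sum_le X₁ X₂ (fun p : ℕ × ℕ ↦ A p.1 p.2) hD₁
  have hBl := norm_sq_fiber_sum_sum_le Y₁ Y₂ (fun p : ℕ × ℕ ↦ B p.1 p.2) hD₂
  have h1 : Real.sqrt (∑ u ∈ Icc 1 (X₁ * X₂), ‖α u‖ ^ 2) ≤
      Real.sqrt D₁ * Real.sqrt (∑ p ∈ Icc 1 X₁ ×ˢ Icc 1 X₂, ‖A p.1 p.2‖ ^ 2) := by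
    rw [← Real.sqrt_mul hD₁0]
    exact Real.sqrt_le_sqrt hAl
  have h2 : Real.sqrt (∑ v ∈ Icc 1 (Y₁ * Y₂), ‖β v‖ ^ 2) ≤
      Real.sqrt D₂ * Real.sqrt (∑ p ∈ Icc 1 Y₁ ×ˢ Icc 1 Y₂, ‖B p.1 p.2‖ ^ 2) := by
    rw [← Real.sqrt_mul hD₂0]
    exact Real.sqrt_le_sqrt hBl
  -- the right-hand-side factors are non-negative
  have hP0 : 0 ≤ ((q * r : ℕ) : ℝ) ^ (1 + ε) *
      (Pascadi2025.bracket71 (σ₁ * (X₁ * X₂) : ℕ) (σ₂ * (Y₁ * Y₂) : ℕ) ((q * r : ℕ) : ℝ) r r) ^ (1 / 6 : ℝ) := by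
    refine mul_nonneg (Real.rpow_nonneg (Nat.cast_nonneg _) _) (Real.rpow_nonneg ?_ _)
    unfold Pascadi2025.bracket71
    positivity
  have hCle : C ≤ max C 0 := le_max_left _ _
  have hM0 : 0 ≤ max C 0 := le_max_right _ _
  calc ‖∑ u ∈ Icc 1 (X₁ * X₂), ∑ v ∈ Icc 1 (Y₁ * Y₂), α u * β v *
          kloostermanSum (q * r) ((σ₁ * u : ℕ) : ZMod (q * r)) ((σ₂ * v : ℕ) : ZMod (q * r))‖
      ≤ C * Real.sqrt (∑ u ∈ Icc 1 (X₁ * X₂), ‖α u‖ ^ 2) * Real.sqrt (∑ v ∈ Icc 1 (Y₁ * Y₂), ‖β v‖ ^ 2) *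
          ((q * r : ℕ) : ℝ) ^ (1 + ε) *
          (Pascadi2025.bracket71 (σ₁ * (X₁ * X₂) : ℕ) (σ₂ * (Y₁ * Y₂) : ℕ) ((q * r : ℕ) : ℝ) r r) ^ (1 / 6 : ℝ) := key
    _ ≤ max C 0 * (Real.sqrt D₁ * Real.sqrt (∑ p ∈ Icc 1 X₁ ×ˢ Icc 1 X₂, ‖A p.1 p.2‖ ^ 2)) *
          (Real.sqrt D₂ * Real.sqrt (∑ p ∈ Icc 1 Y₁ ×ˢ Icc 1 Y₂, ‖B p.1 p.2‖ ^ 2)) *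
          (((q * r : ℕ) : ℝ) ^ (1 + ε) *
          (Pascadi2025.bracket71 (σ₁ * (X₁ * X₂) : ℕ) (σ₂ * (Y₁ * Y₂) : ℕ) ((q * r : ℕ) : ℝ) r r) ^ (1 / 6 : ℝ)) := by
        rw [mul_assoc (C * _ * _)]
        refine mul_le_mul ?_ le_rfl hP0 (by positivity)
        exact mul_le_mul (mul_le_mul hCle h1 (Real.sqrt_nonneg _) hM0) h2 (Real.sqrt_nonneg _) (by positivity)
    _ = _ := by ring

end Summit.Parity.GeneralizedHardyLittlewood.Theorems.MomentsBeyondDiagonal.Layers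

end
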